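import Literature.MathematicalPhysics.QuantumLattice.HubbardMomentumModeCommutators
import Literature.MathematicalPhysics.QuantumLattice.HubbardWave0PosSemidefProofs
import Literature.MathematicalPhysics.QuantumLattice.TorusCooperSum
import HarnessLib

/-!
# Bloch-mode variational bounds for the Hubbard torus and the level spacing of the square-lattice band

Topic `MathematicalPhysics/QuantumLattice` (family `hubbard`); proof-only.  Part 2 of the a-priori
parity-gap ceiling (`HubbardParityGapCeiling.lean`, route `HubbardSuperconductivity/ParityGapRigidity`,
items `GappedWindow` stmt-HubbardSuperconductivity-2196 / `NoUniformParityGap` stmt-…-2198).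

* `torusBand_update_sub`, `exists_torusBand_lt_le_add` — **level spacing** of
  `ε_L(k) = -2(cos(2πk₁/L) + cos(2πk₂/L))` on an EVEN torus: below the top of the band every level
  has a strictly higher level within `4π/L` (shift one coordinate whose cosine is not `-1` one step
  towards the zone corner; `cos` is `1`-Lipschitz and strictly monotone on `[0, π]`).  The free band
  has no bulk spectral gap — the only input about the lattice the ceiling uses.
* `isNParticle_momentumCreation_mulVec`, `isNParticle_momentumAnnihilation_mulVec`,
  `normSq_momentumCreation_add_normSq_momentumAnnihilation` (`‖c†_kψ‖² + ‖c_kψ‖² = ‖ψ‖²`),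
  `star_dotProduct_momentumNumber_mulVec` (`⟨ψ, n_{k↑}ψ⟩ = ‖c_{k↑}ψ‖²`) — Bloch-mode bookkeeping.
* `groundEnergy_succ_le_momentum`, `groundEnergy_pred_le_momentum` — **the one-particle variational
  bounds**: if `Hψ = Eψ` for `H = hubbardTorus 2 L 1 U` (`L ≥ 3`, any real `U`) and `ψ` is a unit
  `N`-particle vector, then for every Bloch mode `k` with `c†_{k↑}ψ ≠ 0` (resp. `c_{k↑}ψ ≠ 0`)
  `E(N+1) ≤ E + ε_L(k) + |U|/‖c†_{k↑}ψ‖` and `E(N-1) ≤ E - ε_L(k) + |U|/‖c_{k↑}ψ‖`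
  (`[H, c†_k] = ε_k c†_k + U T_k`, `‖T_kψ‖ ≤ 1`, `HubbardMomentumModeCommutators`; the variational
  split `re_expect_le_of_split` of `HubbardUniformOneParticleCost`).  Compared with the tree's
  `exists_creation_rayleigh_le` (best SITE: cost `≤ Δ|t| + |U|`) the Bloch mode makes the kinetic
  cost EXACTLY `±ε_L(k)`, so that it cancels between particle addition and removal.

Everything is proved; no definitions, no named facts.  Sources: H. Tasaki, *Physics and Mathematics of
Quantum Many-Body Systems* (2020) §2.1 (variational principle), §9.3; Bratteli–Robinson II §5.2.1.
Folklore finite-dimensional statements.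

## Mathlib / tree search

Mathlib: `Real.cos_lt_cos_of_nonneg_of_le_pi`, `Real.cos_two_pi_sub`, `Real.abs_cos_sub_cos_le`,
`ZMod.val_natCast`, `Function.update`.  Tree (REUSED): `torusBand`, `torusBand_le_four`,
`momentumCreation_eq_sum`, `momentumAnnihilation_mul_momentumCreation_add`,
`IsNParticle.creation_mulVec_holds`, `PosSemidefTrace.isNParticle_annihilation_mulVec`,
`LiebThm1.groundEnergy_mul_norm_le`, `re_expect_le_of_split`, `norm_toLp_sq`.
-/

noncomputable section

namespace Literature.MathematicalPhysics.QuantumLattice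

open Matrix Finset HubbardWave0 ThermodynamicLimit Literature.Probability.LatticeModels
open scoped ComplexOrder ComplexConjugate Matrix.Norms.L2Operator InnerProductSpace

section LevelSpacing

variable {d L : ℕ} [NeZero L]

omit [NeZero L] in
/-- Changing one coordinate of a torus momentum changes the band energy by the change of one
cosine: `ε_L(k[i ↦ w]) - ε_L(k) = -2 (cos(2π w/L) - cos(2π kᵢ/L))`. [folklore] -/
theorem torusBand_update_sub (k : TorusSite d L) (i : Fin d) (w : ZMod L) :
    torusBand L (Function.update k i w) - torusBand L k =
      -2 * (Real.cos (2 * Real.pi * (w.val : ℝ) / L) - Real.cos (2 * Real.pi * ((k i).val : ℝ) / L)) := by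
  classical
  have hlm : ∀ (q : TorusSite d L) (j : Fin d),
      latticeMomentum L q j = 2 * Real.pi * ((q j).val : ℝ) / L := fun _ _ => rfl
  unfold torusBand
  rw [← Finset.add_sum_erase _ _ (Finset.mem_univ i),
    ← Finset.add_sum_erase _ (fun j => Real.cos (latticeMomentum L k j)) (Finset.mem_univ i)]
  have hsame : ∑ j ∈ Finset.univ.erase i, Real.cos (latticeMomentum L (Function.update k i w) j) =
      ∑ j ∈ Finset.univ.erase i, Real.cos (latticeMomentum L k j) := by
    refine Finset.sum_congr rfl fun j hj => ?_
    have hji : j ≠ i := Finset.ne_of_mem_erase hj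
    rw [hlm, hlm, Function.update_of_ne hji]
  rw [hsame, hlm, hlm, Function.update_self]
  ring

/-- **Level spacing of the square-lattice band on an even torus.** For even `L` and every momentum
`k` below the top of the band (`ε_L(k) < 4`) there is a momentum `k'` with
`ε_L(k) < ε_L(k') ≤ ε_L(k) + 4π/L`: move one coordinate whose cosine is not `-1` by one lattice
step towards the zone corner (`cos` is `1`-Lipschitz and strictly monotone on `[0, π]`).  In
particular consecutive distinct levels of `ε_L` are at most `4π/L` apart: the free band has no
spectral gap in the bulk. [folklore] -/
theorem exists_torusBand_lt_le_add (hLe : Even L) (k : TorusSite 2 L) (hk : torusBand L k < 4) :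
    ∃ k' : TorusSite 2 L, torusBand L k < torusBand L k' ∧
      torusBand L k' ≤ torusBand L k + 4 * Real.pi / L := by
  classical
  have hL0 : L ≠ 0 := NeZero.ne L
  have hL2 : 2 ≤ L := by obtain ⟨m, hm⟩ := hLe; omega
  have hLr : (0 : ℝ) < L := by exact_mod_cast (show 0 < L by omega)
  -- a coordinate whose cosine is not `-1`
  have hlm : ∀ (q : TorusSite 2 L) (j : Fin 2),
      latticeMomentum L q j = 2 * Real.pi * ((q j).val : ℝ) / L := fun _ _ => rfl
  obtain ⟨i, hi⟩ : ∃ i : Fin 2, Real.cos (2 * Real.pi * (((k i).val : ℕ) : ℝ) / L) ≠ -1 := by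
    by_contra h
    push Not at h
    have h4 : torusBand L k = 4 := by
      unfold torusBand
      simp only [Fin.sum_univ_two, hlm, h]
      norm_num
    linarith
  set v : ℕ := (k i).val with hv
  have hvL : v < L := ZMod.val_lt (k i)
  have h2v : 2 * v ≠ L := by
    intro h2
    apply hi
    have : 2 * Real.pi * ((v : ℕ) : ℝ) / L = Real.pi := by
      have hLv : (L : ℝ) = 2 * (v : ℝ) := by exact_mod_cast h2.symm
      rw [hLv]
      have hv0 : (v : ℝ) ≠ 0 := by
        intro hv0
        have : v = 0 := by exact_mod_cast hv0
        omega
      field_simp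
    rw [this, Real.cos_pi]
  -- the shifted coordinate
  set v' : ℕ := if 2 * v < L then v + 1 else v - 1 with hv'
  have hv'L : v' < L := by
    rw [hv']; split_ifs <;> omega
  set k' : TorusSite 2 L := Function.update k i ((v' : ℕ) : ZMod L) with hk'
  have hval : (((v' : ℕ) : ZMod L)).val = v' := by
    rw [ZMod.val_natCast, Nat.mod_eq_of_lt hv'L]
  -- the two cosines
  set θ : ℝ := 2 * Real.pi * (v : ℝ) / L with hθ
  set θ' : ℝ := 2 * Real.pi * (v' : ℝ) / L with hθ'
  have hdiff : torusBand L k' - torusBand L k = -2 * (Real.cos θ' - Real.cos θ) := by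
    rw [hk', torusBand_update_sub, hval]
  -- strict decrease of the cosine
  have hstrict : Real.cos θ' < Real.cos θ := by
    by_cases hlt : 2 * v < L
    · have hv'e : v' = v + 1 := by rw [hv', if_pos hlt]
      have h2 : 2 * (v + 1) ≤ L := by
        obtain ⟨m, hm⟩ := hLe; omega
      have hθ0 : 0 ≤ θ := by rw [hθ]; positivity
      have hθ'π : θ' ≤ Real.pi := by
        rw [hθ', hv'e, div_le_iff₀ hLr]
        have : (2 * ((v + 1 : ℕ) : ℝ)) ≤ L := by exact_mod_cast h2
        push_cast at this ⊢
        nlinarith [Real.pi_pos]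
      have hθθ' : θ < θ' := by
        rw [hθ, hθ', hv'e]
        push_cast
        have : (0 : ℝ) < 2 * Real.pi / L := by positivity
        rw [div_lt_div_iff_of_pos_right hLr]
        nlinarith [Real.pi_pos]
      exact Real.cos_lt_cos_of_nonneg_of_le_pi hθ0 hθ'π hθθ'
    · have hge : L + 2 ≤ 2 * v := by
        obtain ⟨m, hm⟩ := hLe; omega
      have hv'e : v' = v - 1 := by rw [hv', if_neg hlt]
      have hv1 : 1 ≤ v := by omega
      -- reflect: `cos x = cos (2π - x)` with `0 < 2π - θ < 2π - θ' ≤ π`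
      have hx0 : 0 ≤ 2 * Real.pi - θ := by
        rw [hθ, sub_nonneg, div_le_iff₀ hLr]
        have : ((v : ℕ) : ℝ) ≤ L := by exact_mod_cast hvL.le
        nlinarith [Real.pi_pos]
      have hyπ : 2 * Real.pi - θ' ≤ Real.pi := by
        rw [hθ', hv'e]
        have h2 : (L : ℝ) ≤ 2 * ((v - 1 : ℕ) : ℝ) := by
          have : L ≤ 2 * (v - 1) := by omega
          exact_mod_cast this
        have : Real.pi ≤ 2 * Real.pi * ((v - 1 : ℕ) : ℝ) / L := by
          rw [le_div_iff₀ hLr]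
          nlinarith [Real.pi_pos]
        linarith
      have hxy : 2 * Real.pi - θ < 2 * Real.pi - θ' := by
        rw [hθ, hθ', hv'e]
        have : ((v - 1 : ℕ) : ℝ) < (v : ℝ) := by
          rw [Nat.cast_sub hv1]; simp
        have h1 : 2 * Real.pi * ((v - 1 : ℕ) : ℝ) / L < 2 * Real.pi * (v : ℝ) / L := by
          rw [div_lt_div_iff_of_pos_right hLr]
          nlinarith [Real.pi_pos]
        linarith
      have h := Real.cos_lt_cos_of_nonneg_of_le_pi hx0 hyπ hxy
      rwa [Real.cos_two_pi_sub, Real.cos_two_pi_sub] at h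
  -- Lipschitz bound
  have hlip : Real.cos θ - Real.cos θ' ≤ 2 * Real.pi / L := by
    have h := Real.abs_cos_sub_cos_le θ θ'
    have hθd : |θ - θ'| = 2 * Real.pi / L := by
      rw [hθ, hθ']
      have : |(v : ℝ) - (v' : ℝ)| = 1 := by
        rw [hv']
        split_ifs with hlt
        · push_cast; rw [abs_of_nonpos (by linarith)]; ring
        · have hv1 : 1 ≤ v := by omega
          rw [Nat.cast_sub hv1]; push_cast; rw [abs_of_nonneg (by linarith)]; ring
      rw [show 2 * Real.pi * (v : ℝ) / L - 2 * Real.pi * (v' : ℝ) / L =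
        (2 * Real.pi / L) * ((v : ℝ) - (v' : ℝ)) by ring, abs_mul, this, mul_one,
        abs_of_pos (by positivity)]
    rw [hθd] at h
    exact (le_abs_self _).trans h
  refine ⟨k', by linarith, ?_⟩
  rw [show (4 : ℝ) * Real.pi / L = 2 * (2 * Real.pi / L) by ring]
  linarith

end LevelSpacing

/-! ### One-particle variational bounds with Bloch modes -/

section Variational

variable {L : ℕ} [NeZero L]

omit [NeZero L] in
/-- A finite linear combination of `N`-particle vectors is an `N`-particle vector. [folklore] -/
theorem isNParticle_sum_smul {ι κ : Type*} [LinearOrder ι] (s : Finset κ) (c : κ → ℂ)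
    (v : κ → Fock ι) {N : ℕ} (hv : ∀ j ∈ s, IsNParticle N (v j)) :
    IsNParticle N (∑ j ∈ s, c j • v j) := by
  intro t ht
  rw [Finset.sum_apply]
  refine Finset.sum_eq_zero fun j hj => ?_
  rw [Pi.smul_apply, hv j hj t ht, smul_zero]

/-- `c†_{k↑}` raises the particle number by one. [folklore] -/
theorem isNParticle_momentumCreation_mulVec (k : TorusSite 2 L) {N : ℕ}
    {ψ : Fock (Orb (FermionTorus 2 L))} (hψ : IsNParticle N ψ) :
    IsNParticle (N + 1) (momentumCreation k 0 *ᵥ ψ) := by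
  rw [momentumCreation_eq_sum, Matrix.sum_mulVec]
  simp only [Matrix.smul_mulVec]
  exact isNParticle_sum_smul _ _ _ fun z _ => IsNParticle.creation_mulVec_holds hψ _

/-- `c_{k↑}` lowers the particle number by one. [folklore] -/
theorem isNParticle_momentumAnnihilation_mulVec (k : TorusSite 2 L) {N : ℕ}
    {ψ : Fock (Orb (FermionTorus 2 L))} (hψ : IsNParticle N ψ) :
    IsNParticle (N - 1) (momentumAnnihilation k 0 *ᵥ ψ) := by
  unfold momentumAnnihilation
  rw [Matrix.sum_mulVec]
  simp only [Matrix.smul_mulVec]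
  exact isNParticle_sum_smul _ _ _ fun z _ => PosSemidefTrace.isNParticle_annihilation_mulVec hψ _

/-- **CAR norm identity for a Bloch mode**: `‖c†_{k↑} ψ‖² + ‖c_{k↑} ψ‖² = ‖ψ‖²`
(`c_k c†_k + c†_k c_k = 1`). Bratteli–Robinson II §5.2.1. [folklore] -/
theorem normSq_momentumCreation_add_normSq_momentumAnnihilation (k : TorusSite 2 L)
    (ψ : Fock (Orb (FermionTorus 2 L))) :
    (star (momentumCreation k 0 *ᵥ ψ) ⬝ᵥ (momentumCreation k 0 *ᵥ ψ)).re +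
        (star (momentumAnnihilation k 0 *ᵥ ψ) ⬝ᵥ (momentumAnnihilation k 0 *ᵥ ψ)).re =
      (star ψ ⬝ᵥ ψ).re := by
  have hcar := momentumAnnihilation_mul_momentumCreation_add k k (0 : Fin 2) 0
  rw [if_pos ⟨rfl, rfl⟩] at hcar
  rw [star_mulVec_dotProduct (momentumCreation k 0) ψ, momentumCreation_conjTranspose,
    star_mulVec_dotProduct (momentumAnnihilation k 0) ψ, momentumAnnihilation_conjTranspose,
    mulVec_mulVec, mulVec_mulVec, ← Complex.add_re, ← dotProduct_add, ← add_mulVec, hcar, one_mulVec]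

/-- The occupation of the Bloch mode `(k, ↑)` is `‖c_{k↑} ψ‖²`: `⟨ψ, n_{k↑} ψ⟩ = ⟨c_{k↑}ψ, c_{k↑}ψ⟩`.
[folklore] -/
theorem star_dotProduct_momentumNumber_mulVec (k : TorusSite 2 L) (ψ : Fock (Orb (FermionTorus 2 L))) :
    star ψ ⬝ᵥ (momentumNumber k 0 *ᵥ ψ) =
      star (momentumAnnihilation k 0 *ᵥ ψ) ⬝ᵥ (momentumAnnihilation k 0 *ᵥ ψ) := by
  rw [star_mulVec_dotProduct (momentumAnnihilation k 0) ψ, momentumAnnihilation_conjTranspose,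
    mulVec_mulVec]
  rfl

/-- **Particle-addition bound with a Bloch mode.** Let `Hψ = Eψ` for `H = hubbardTorus 2 L 1 U`
(`L ≥ 3`, any real `U`), `ψ` a unit `N`-particle vector with `c†_{k↑} ψ ≠ 0`.  Then
`E(N+1) ≤ E + ε_L(k) + |U| / ‖c†_{k↑} ψ‖`: `H c†_k ψ = (E + ε_L(k)) c†_k ψ + U T_k ψ` with
`‖T_k ψ‖ ≤ 1` (`hubbardTorus_commutator_momentumCreation`, `normSq_dressed_mulVec_le`) and the
variational principle. Tasaki (2020) §2.1, §9.3. [folklore] -/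
theorem groundEnergy_succ_le_momentum (hL : 3 ≤ L) (U : ℝ) {N : ℕ}
    {ψ : Fock (Orb (FermionTorus 2 L))} (hN : IsNParticle N ψ) (h1 : star ψ ⬝ᵥ ψ = 1) {E : ℝ}
    (hE : hubbardTorus 2 L 1 U *ᵥ ψ = (E : ℂ) • ψ) (k : TorusSite 2 L)
    (hk : momentumCreation k 0 *ᵥ ψ ≠ 0) :
    groundEnergy (hubbardTorus 2 L 1 U) (N + 1) ≤ E + torusBand L k +
      |U| / ‖(WithLp.toLp 2 (momentumCreation k 0 *ᵥ ψ) :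
        EuclideanSpace ℂ (Finset (Orb (FermionTorus 2 L))))‖ := by
  set H := hubbardTorus 2 L 1 U with hH
  set φ := momentumCreation k 0 *ᵥ ψ with hφ
  set T : Matrix (Finset (Orb (FermionTorus 2 L))) (Finset (Orb (FermionTorus 2 L))) ℂ :=
    ∑ z : FermionTorus 2 L, (torusFourierWeight 2 L * torusChar k z.toTorusSite) •
      (numberOp z 1 * creation (orb z 0)) with hT
  have hcomm := hubbardTorus_commutator_momentumCreation hL U k
  rw [← hH, ← hT] at hcomm
  -- the split `Hφ = (E + ε) φ + U Tψ`
  have hsplit : H *ᵥ φ = (((E + torusBand L k : ℝ)) : ℂ) • φ + (U : ℂ) • (T *ᵥ ψ) := by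
    have hmul : H * momentumCreation k 0 =
        momentumCreation k 0 * H + (((torusBand L k : ℝ) : ℂ) • momentumCreation k 0 + (U : ℂ) • T) :=
      (sub_eq_iff_eq_add'.1 hcomm)
    rw [hφ, mulVec_mulVec, hmul, add_mulVec, add_mulVec, ← mulVec_mulVec, hE, mulVec_smul, smul_mulVec,
      smul_mulVec, Complex.ofReal_add, add_smul]
    abel
  -- norm of the remainder
  have hφpos : 0 < ‖(WithLp.toLp 2 φ : EuclideanSpace ℂ (Finset (Orb (FermionTorus 2 L))))‖ := by
    refine norm_pos_iff.2 fun h => hk ?_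
    have := congrArg WithLp.ofLp h
    simpa using this
  have hTψ : ‖(WithLp.toLp 2 (T *ᵥ ψ) : EuclideanSpace ℂ (Finset (Orb (FermionTorus 2 L))))‖ ≤ 1 := by
    have h := normSq_dressed_mulVec_le (fun z : FermionTorus 2 L =>
      torusFourierWeight 2 L * torusChar k z.toTorusSite) ψ
    rw [← hT, sum_normSq_planeWaveCoeff, one_mul, h1, Complex.one_re, ← norm_toLp_sq] at h
    nlinarith [norm_nonneg (WithLp.toLp 2 (T *ᵥ ψ) : EuclideanSpace ℂ (Finset (Orb (FermionTorus 2 L))))]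
  set κ : ℝ := |U| / ‖(WithLp.toLp 2 φ : EuclideanSpace ℂ (Finset (Orb (FermionTorus 2 L))))‖ with hκ
  have hw : ‖(WithLp.toLp 2 ((U : ℂ) • (T *ᵥ ψ)) : EuclideanSpace ℂ (Finset (Orb (FermionTorus 2 L))))‖ ≤
      κ * ‖(WithLp.toLp 2 φ : EuclideanSpace ℂ (Finset (Orb (FermionTorus 2 L))))‖ := by
    rw [hκ, div_mul_cancel₀ _ hφpos.ne', WithLp.toLp_smul, norm_smul, Complex.norm_real,
      Real.norm_eq_abs]
    exact mul_le_of_le_one_right (abs_nonneg _) hTψ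
  have hray := re_expect_le_of_split H hsplit hw
  have hvar := LiebThm1.groundEnergy_mul_norm_le H (isNParticle_momentumCreation_mulVec k hN)
  rw [← hφ] at hvar
  have hφ2 : 0 < (star φ ⬝ᵥ φ).re := by rw [← norm_toLp_sq]; positivity
  have : groundEnergy H (N + 1) * (star φ ⬝ᵥ φ).re ≤ (E + torusBand L k + κ) * (star φ ⬝ᵥ φ).re :=
    hvar.trans hray
  exact le_of_mul_le_mul_right this hφ2

/-- **Particle-removal bound with a Bloch mode.** With the data of
`groundEnergy_succ_le_momentum` and `c_{k↑} ψ ≠ 0`: `E(N-1) ≤ E - ε_L(k) + |U| / ‖c_{k↑} ψ‖`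
(`H c_k ψ = (E - ε_L(k)) c_k ψ - U T_k† ψ`, `‖T_k† ψ‖ ≤ 1`). Tasaki (2020) §2.1, §9.3. [folklore] -/
theorem groundEnergy_pred_le_momentum (hL : 3 ≤ L) (U : ℝ) {N : ℕ}
    {ψ : Fock (Orb (FermionTorus 2 L))} (hN : IsNParticle N ψ) (h1 : star ψ ⬝ᵥ ψ = 1) {E : ℝ}
    (hE : hubbardTorus 2 L 1 U *ᵥ ψ = (E : ℂ) • ψ) (k : TorusSite 2 L)
    (hk : momentumAnnihilation k 0 *ᵥ ψ ≠ 0) :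
    groundEnergy (hubbardTorus 2 L 1 U) (N - 1) ≤ E - torusBand L k +
      |U| / ‖(WithLp.toLp 2 (momentumAnnihilation k 0 *ᵥ ψ) :
        EuclideanSpace ℂ (Finset (Orb (FermionTorus 2 L))))‖ := by
  set H := hubbardTorus 2 L 1 U with hH
  set φ := momentumAnnihilation k 0 *ᵥ ψ with hφ
  set T : Matrix (Finset (Orb (FermionTorus 2 L))) (Finset (Orb (FermionTorus 2 L))) ℂ :=
    ∑ z : FermionTorus 2 L, (torusFourierWeight 2 L * torusChar k z.toTorusSite) •
      (numberOp z 1 * creation (orb z 0)) with hT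
  have hcomm := hubbardTorus_commutator_momentumAnnihilation hL U k
  rw [← hH, ← hT] at hcomm
  have hsplit : H *ᵥ φ = (((E - torusBand L k : ℝ)) : ℂ) • φ + (-(U : ℂ)) • (Tᴴ *ᵥ ψ) := by
    have hmul : H * momentumAnnihilation k 0 =
        momentumAnnihilation k 0 * H + (-(((torusBand L k : ℝ) : ℂ) • momentumAnnihilation k 0) -
          (U : ℂ) • Tᴴ) :=
      (sub_eq_iff_eq_add'.1 hcomm)
    rw [hφ, mulVec_mulVec, hmul, add_mulVec, sub_mulVec, neg_mulVec, ← mulVec_mulVec, hE, mulVec_smul,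
      smul_mulVec, smul_mulVec, Complex.ofReal_sub, sub_smul, neg_smul]
    abel
  have hφpos : 0 < ‖(WithLp.toLp 2 φ : EuclideanSpace ℂ (Finset (Orb (FermionTorus 2 L))))‖ := by
    refine norm_pos_iff.2 fun h => hk ?_
    have := congrArg WithLp.ofLp h
    simpa using this
  have hTψ : ‖(WithLp.toLp 2 (Tᴴ *ᵥ ψ) : EuclideanSpace ℂ (Finset (Orb (FermionTorus 2 L))))‖ ≤ 1 := by
    have h := normSq_dressed_conjTranspose_mulVec_le (fun z : FermionTorus 2 L =>
      torusFourierWeight 2 L * torusChar k z.toTorusSite) ψ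
    rw [← hT, sum_normSq_planeWaveCoeff, one_mul, h1, Complex.one_re, ← norm_toLp_sq] at h
    nlinarith [norm_nonneg (WithLp.toLp 2 (Tᴴ *ᵥ ψ) : EuclideanSpace ℂ (Finset (Orb (FermionTorus 2 L))))]
  set κ : ℝ := |U| / ‖(WithLp.toLp 2 φ : EuclideanSpace ℂ (Finset (Orb (FermionTorus 2 L))))‖ with hκ
  have hw : ‖(WithLp.toLp 2 ((-(U : ℂ)) • (Tᴴ *ᵥ ψ)) : EuclideanSpace ℂ (Finset (Orb (FermionTorus 2 L))))‖ ≤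
      κ * ‖(WithLp.toLp 2 φ : EuclideanSpace ℂ (Finset (Orb (FermionTorus 2 L))))‖ := by
    rw [hκ, div_mul_cancel₀ _ hφpos.ne', WithLp.toLp_smul, norm_smul, norm_neg, Complex.norm_real,
      Real.norm_eq_abs]
    exact mul_le_of_le_one_right (abs_nonneg _) hTψ
  have hray := re_expect_le_of_split H hsplit hw
  have hvar := LiebThm1.groundEnergy_mul_norm_le H (isNParticle_momentumAnnihilation_mulVec k hN)
  rw [← hφ] at hvar
  have hφ2 : 0 < (star φ ⬝ᵥ φ).re := by rw [← norm_toLp_sq]; positivity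
  have : groundEnergy H (N - 1) * (star φ ⬝ᵥ φ).re ≤ (E - torusBand L k + κ) * (star φ ⬝ᵥ φ).re :=
    hvar.trans hray
  exact le_of_mul_le_mul_right this hφ2

end Variational

end Literature.MathematicalPhysics.QuantumLattice

end
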